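import Literature.Claims.NS.Kampen2015
import Mathlib.Analysis.SpecialFunctions.Gaussian.GaussianIntegral
import Mathlib.Analysis.SpecialFunctions.Trigonometric.Bounds
import HarnessLib

/-!
# C13b `Kampen2015` (arXiv:1502.06699 v3) — refuter's kernel kill of the cone-bound rule (12)–(13) p. 3
# at the function grain (`Step_1Abs`)
(cell `ns-claims`, D-0090; refuter `ns-claims-refuter-7`; referee `ns-claims-ref-3`; skeleton
`Literature.Claims.NS.Kampen2015` p474485 by typist-12, whose docstring of `Step_1Abs` pre-registered the
kill route «a periodised bump of height r(t)^{−3/4} and width r(t) = exp(−1/(t_s − t))»; companion of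
`SoloRefuteKampen2015.lean` (`not_Step_3`, `not_Step_5`))

`not_Step_1Abs` refutes `Literature.Claims.NS.Kampen2015.Step_1Abs`, the inference behind display (12)
p. 3: «(5) implies v_i ∈ L^{8/3}([t₀,t_s],L⁴(𝕋³)) … for all (t,x) ∈ K: |v_i(t,x)| ≤ c/((t_s − t)^μ|x − x_s|^λ)
… 0 ≤ μ < 3/8, 0 ≤ λ < 3/4 (13)», typed as a rule about fields on `(t₀,t_s) × 𝕋³` with smooth lift and
finite `L^{8/3}_t L⁴_x` norm. WITNESS (`t₀ = 0`, `t_s = 1`, `x_s = 0`): the periodic Gaussian-type profile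
`w(t,y) = e^{3/(4u)} · exp(Σᵢ (cos 2πyᵢ − 1)/r²) · e₀`, `u = 1 − t`, `r = r(t) = e^{−1/u}` — smooth on the
open slab, with `‖w(t)‖⁴_{L⁴(𝕋³)} = e^{3/u} I(r)³ ≤ e^{3/u} (r√(π/32))³ = (π/32)^{3/2}` for every `t` (Jordan's
inequality `cos 2πs − 1 ≤ −8s²` on `|s| ≤ ½` and the Gaussian integral), so the `L^{8/3}_tL⁴_x` quantity
is finite; but at the cone points `(1 − u, r(t)e₀)` the weighted size is
`≥ e^{−2π²} u^μ e^{(3/4 − λ)/u} ≥ e^{−2π²}(3/4 − λ) u^{μ−1} → ∞` as `u ↓ 0`, for EVERY admissible `(μ, λ)`: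
integrability does not give a pointwise rate. [refuted-substantive at the typed function grain; the
PDE-grain instance `Step_1` (smooth representatives of Leray–Hopf solutions) is not touched — there the
sentence is an un-derived regularity-type assertion.]

WHAT THIS IS NOT: not a claim about the Navier–Stokes problem itself; not a claim about any author
beyond the typed locator.
-/

set_option linter.dupNamespace false

open MeasureTheory Set Filter
open scoped ENNReal ContDiff Topology

namespace Summit.NavierStokesRegularity.NavierStokesRegularity.Theorems.Kampen2015

open Literature.Analysis.FunctionSpaces Literature.Claims.NS.Kampen2015

noncomputable section

/-! ## The circle cosine `θ ↦ cos 2πθ` -/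

/-- `cos 2πθ` as a function on the unit additive circle (real part of `toCircle`). -/
def cosC (θ : UnitAddCircle) : ℝ := ((AddCircle.toCircle θ : Circle) : ℂ).re

/-- `cosC ↑x = cos (2πx)`. -/
theorem cosC_coe (x : ℝ) : cosC (x : UnitAddCircle) = Real.cos (2 * Real.pi * x) := by
  unfold cosC
  rw [AddCircle.toCircle_apply_mk]
  simp only [div_one, Circle.coe_exp]
  exact Complex.exp_ofReal_mul_I_re _

/-- `cosC` is continuous. -/
theorem continuous_cosC : Continuous cosC :=
  Complex.continuous_re.comp (continuous_subtype_val.comp AddCircle.continuous_toCircle)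

/-- `cosC θ ≤ 1`. -/
theorem cosC_le_one (θ : UnitAddCircle) : cosC θ ≤ 1 := by
  obtain ⟨x, rfl⟩ := QuotientAddGroup.mk_surjective θ
  rw [show (QuotientAddGroup.mk x : UnitAddCircle) = ((x : ℝ) : UnitAddCircle) from rfl, cosC_coe]
  exact Real.cos_le_one _

/-- Jordan's inequality in the form `cos 2πs − 1 ≤ −8s²` for `|s| ≤ ½`. -/
theorem cos_two_pi_mul_sub_one_le {s : ℝ} (hs : |s| ≤ 1 / 2) :
    Real.cos (2 * Real.pi * s) - 1 ≤ -8 * s ^ 2 := by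
  have hπ := Real.pi_pos
  -- `cos 2πs = 1 − 2 sin²(π s)` and `|sin (π|s|)| ≥ 2|s|`
  have hcos : Real.cos (2 * Real.pi * s) = 1 - 2 * Real.sin (Real.pi * s) ^ 2 := by
    rw [show 2 * Real.pi * s = 2 * (Real.pi * s) by ring, Real.cos_two_mul]
    nlinarith [Real.sin_sq_add_cos_sq (Real.pi * s)]
  have habs : 0 ≤ |s| := abs_nonneg s
  have hsin : 2 * |s| ≤ Real.sin (Real.pi * |s|) := by
    have h1 : 2 / Real.pi * (Real.pi * |s|) ≤ Real.sin (Real.pi * |s|) :=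
      Real.mul_le_sin (by positivity) (by nlinarith)
    have h2 : 2 / Real.pi * (Real.pi * |s|) = 2 * |s| := by field_simp
    linarith
  have hsq : Real.sin (Real.pi * s) ^ 2 = Real.sin (Real.pi * |s|) ^ 2 := by
    rcases abs_choice s with h | h
    · rw [h]
    · rw [h, mul_neg, Real.sin_neg, neg_sq]
  rw [hcos, hsq]
  nlinarith [sq_abs s, hsin, abs_nonneg s]

/-! ## The witness field -/

/-- The width `r(t) = exp(−1/(1 − t))`. -/
def width (t : ℝ) : ℝ := Real.exp (-(1 / (1 - t)))

/-- The amplitude `A(t) = exp((3/4)/(1 − t))` (`= r(t)^{−3/4}`). -/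
def amp (t : ℝ) : ℝ := Real.exp (3 / 4 / (1 - t))

/-- The spatial profile `exp(Σᵢ (cos 2πyᵢ − 1)/r²)` on `𝕋³` (a periodic Gaussian of width `∼ r`). -/
def profile (r : ℝ) (y : T3) : ℝ := Real.exp ((∑ i, (cosC (y i) - 1)) / r ^ 2)

/-- The witness `w(t,y) = A(t)·profile_{r(t)}(y)·e₀`. -/
def wC (t : ℝ) (y : T3) : E3 := (amp t * profile (width t) y) • EuclideanSpace.single 0 1

/-- Positivity of the amplitude. -/
theorem amp_pos (t : ℝ) : 0 < amp t := Real.exp_pos _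

/-- Positivity of the width. -/
theorem width_pos (t : ℝ) : 0 < width t := Real.exp_pos _

/-- `‖r·e₀‖ = |r|` in `ℝ³`. -/
theorem norm_single_zero (r : ℝ) : ‖(EuclideanSpace.single 0 r : E3)‖ = |r| := by
  rw [← Real.norm_eq_abs]
  exact PiLp.norm_single 2 (fun _ : Fin 3 => ℝ) 0 r

/-- Positivity of the scalar factor. -/
theorem amp_mul_profile_pos (t : ℝ) (y : T3) : 0 < amp t * profile (width t) y :=
  mul_pos (Real.exp_pos _) (Real.exp_pos _)

/-- `‖w(t,y)‖ = A(t)·profile_{r(t)}(y)`. -/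
theorem norm_wC (t : ℝ) (y : T3) : ‖wC t y‖ = amp t * profile (width t) y := by
  rw [wC, norm_smul, norm_single_zero, abs_one, mul_one,
    Real.norm_of_nonneg (amp_mul_profile_pos t y).le]

/-- The lift of the witness to `ℝ × ℝ³` in closed form. -/
theorem wC_proj (t : ℝ) (x : E3) :
    wC t (Torus.proj x) =
      (amp t * Real.exp ((∑ i, (Real.cos (2 * Real.pi * x i) - 1)) / width t ^ 2)) •
        EuclideanSpace.single 0 1 := by
  simp only [wC, profile, Torus.proj_apply, cosC_coe]

/-- The lift `(t,x) ↦ w(t, proj x)` is smooth on the open slab `(0,1) × ℝ³`. -/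
theorem contDiffOn_wC :
    ContDiffOn ℝ ∞ (fun q : ℝ × E3 => wC q.1 (Torus.proj q.2)) (Ioo 0 1 ×ˢ univ) := by
  have hfun : (fun q : ℝ × E3 => wC q.1 (Torus.proj q.2)) = fun q : ℝ × E3 =>
      (amp q.1 * Real.exp ((∑ i, (Real.cos (2 * Real.pi * q.2 i) - 1)) / width q.1 ^ 2)) •
        EuclideanSpace.single 0 1 := by
    funext q; exact wC_proj q.1 q.2
  rw [hfun]
  have hne : ∀ q ∈ Ioo (0 : ℝ) 1 ×ˢ (univ : Set E3), 1 - q.1 ≠ 0 := by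
    intro q hq
    have := (mem_prod.1 hq).1.2
    exact ne_of_gt (by linarith)
  have hsub : ContDiffOn ℝ ∞ (fun q : ℝ × E3 => 1 - q.1) (Ioo 0 1 ×ˢ univ) :=
    (contDiff_const.sub contDiff_fst).contDiffOn
  have hamp : ContDiffOn ℝ ∞ (fun q : ℝ × E3 => amp q.1) (Ioo 0 1 ×ˢ univ) :=
    Real.contDiff_exp.comp_contDiffOn (contDiffOn_const.div hsub hne)
  have hwidth : ContDiffOn ℝ ∞ (fun q : ℝ × E3 => width q.1 ^ 2) (Ioo 0 1 ×ˢ univ) :=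
    (Real.contDiff_exp.comp_contDiffOn ((contDiffOn_const.div hsub hne).neg)).pow 2
  have hwne : ∀ q ∈ Ioo (0 : ℝ) 1 ×ˢ (univ : Set E3), width q.1 ^ 2 ≠ 0 :=
    fun q _ => pow_ne_zero 2 (Real.exp_pos _).ne'
  have hcoord : ∀ i : Fin 3, ContDiff ℝ ∞ (fun q : ℝ × E3 => Real.cos (2 * Real.pi * q.2 i) - 1) := by
    intro i
    have hi : ContDiff ℝ ∞ (fun x : E3 => x i) := (EuclideanSpace.proj (𝕜 := ℝ) (ι := Fin 3) i).contDiff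
    exact (Real.contDiff_cos.comp (contDiff_const.mul (hi.comp contDiff_snd))).sub contDiff_const
  have hsum : ContDiff ℝ ∞ (fun q : ℝ × E3 => ∑ i, (Real.cos (2 * Real.pi * q.2 i) - 1)) :=
    ContDiff.sum fun i _ => hcoord i
  have hexp : ContDiffOn ℝ ∞
      (fun q : ℝ × E3 => Real.exp ((∑ i, (Real.cos (2 * Real.pi * q.2 i) - 1)) / width q.1 ^ 2))
      (Ioo 0 1 ×ˢ univ) :=
    Real.contDiff_exp.comp_contDiffOn (hsum.contDiffOn.div hwidth hwne)
  exact (hamp.mul hexp).smul contDiffOn_const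

/-! ## The `L⁴(𝕋³)` norm of the witness is bounded in time -/

/-- The one-dimensional factor `I(r) = ∫_{𝕋¹} exp(4(cos 2πθ − 1)/r²) dθ ≤ r·√(π/32)` for `r > 0`. -/
theorem circle_factor_le {r : ℝ} (hr : 0 < r) :
    ∫ θ : UnitAddCircle, Real.exp (4 * (cosC θ - 1) / r ^ 2) ≤ r * Real.sqrt (Real.pi / 32) := by
  have hb : (0 : ℝ) < 32 / r ^ 2 := by positivity
  -- unfold the circle integral to `∫_{-1/2}^{1/2}`
  have hper := AddCircle.intervalIntegral_preimage 1 (-(1 / 2)) (fun θ => Real.exp (4 * (cosC θ - 1) / r ^ 2))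
  rw [show (-(1 / 2) : ℝ) + 1 = 1 / 2 by norm_num] at hper
  rw [← hper]
  simp only [cosC_coe]
  rw [intervalIntegral.integral_of_le (by norm_num : (-(1 / 2) : ℝ) ≤ 1 / 2)]
  -- compare with the Gaussian on `Ioc (-1/2) (1/2)`, then with the whole line
  have hg : Integrable (fun s : ℝ => Real.exp (-(32 / r ^ 2) * s ^ 2)) := integrable_exp_neg_mul_sq hb
  have hcont : Continuous (fun s : ℝ => Real.exp (4 * (Real.cos (2 * Real.pi * s) - 1) / r ^ 2)) := by
    fun_prop
  calc ∫ s in Ioc (-(1 / 2) : ℝ) (1 / 2), Real.exp (4 * (Real.cos (2 * Real.pi * s) - 1) / r ^ 2)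
      ≤ ∫ s in Ioc (-(1 / 2) : ℝ) (1 / 2), Real.exp (-(32 / r ^ 2) * s ^ 2) := by
        refine setIntegral_mono_on hcont.integrableOn_Ioc hg.integrableOn measurableSet_Ioc ?_
        intro s hs
        have habs : |s| ≤ 1 / 2 := abs_le.2 ⟨by linarith [hs.1], hs.2⟩
        rw [Real.exp_le_exp]
        have hj := cos_two_pi_mul_sub_one_le habs
        have hr2 : 0 < r ^ 2 := by positivity
        rw [div_le_iff₀ hr2]
        have : -(32 / r ^ 2) * s ^ 2 * r ^ 2 = -32 * s ^ 2 := by field_simp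
        rw [this]
        nlinarith
    _ ≤ ∫ s, Real.exp (-(32 / r ^ 2) * s ^ 2) :=
        setIntegral_le_integral hg (Eventually.of_forall fun s => (Real.exp_pos _).le)
    _ = r * Real.sqrt (Real.pi / 32) := by
        rw [integral_gaussian, show Real.pi / (32 / r ^ 2) = Real.pi / 32 * r ^ 2 by field_simp,
          Real.sqrt_mul (by positivity), Real.sqrt_sq hr.le, mul_comm]

/-- `‖w(t,·)‖⁴` in product form: `‖w(t,y)‖⁴ = e^{3/u} ∏ᵢ exp(4(cos 2πyᵢ − 1)/r²)`, `u = 1 − t`. -/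
theorem norm_wC_pow_four (t : ℝ) (y : T3) :
    ‖wC t y‖ ^ 4 = Real.exp (3 / (1 - t)) * ∏ i, Real.exp (4 * (cosC (y i) - 1) / width t ^ 2) := by
  rw [norm_wC, mul_pow, amp, profile, ← Real.exp_nat_mul, ← Real.exp_nat_mul, ← Real.exp_sum]
  congr 1
  · congr 1; push_cast; ring
  · congr 1; push_cast
    rw [Finset.sum_div, Finset.mul_sum]
    refine Finset.sum_congr rfl fun i _ => ?_
    ring

/-- The `L⁴` bound: `∫_{𝕋³} ‖w(t,y)‖⁴ dy ≤ (√(π/32))³` for every `t < 1`. -/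
theorem integral_norm_wC_pow_four_le {t : ℝ} (ht : t < 1) :
    ∫ y : T3, ‖wC t y‖ ^ 4 ≤ Real.sqrt (Real.pi / 32) ^ 3 := by
  have hu : 0 < 1 - t := by linarith
  have hr : 0 < width t := Real.exp_pos _
  simp_rw [norm_wC_pow_four]
  have hprod : ∫ a : T3, ∏ i, Real.exp (4 * (cosC (a i) - 1) / width t ^ 2) =
      ∏ _i : Fin 3, ∫ θ : UnitAddCircle, Real.exp (4 * (cosC θ - 1) / width t ^ 2) :=
    MeasureTheory.integral_fintype_prod_eq_prod
      (fun (_ : Fin 3) (θ : UnitAddCircle) => Real.exp (4 * (cosC θ - 1) / width t ^ 2))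
  rw [integral_const_mul, hprod, Finset.prod_const, Finset.card_univ, Fintype.card_fin]
  have hI0 : 0 ≤ ∫ θ : UnitAddCircle, Real.exp (4 * (cosC θ - 1) / width t ^ 2) :=
    integral_nonneg fun θ => (Real.exp_pos _).le
  have hI := circle_factor_le (r := width t) hr
  have hpow : (∫ θ : UnitAddCircle, Real.exp (4 * (cosC θ - 1) / width t ^ 2)) ^ 3 ≤
      (width t * Real.sqrt (Real.pi / 32)) ^ 3 := pow_le_pow_left₀ hI0 hI 3
  have hr3 : Real.exp (3 / (1 - t)) * width t ^ 3 = 1 := by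
    rw [width, ← Real.exp_nat_mul, ← Real.exp_add]
    push_cast
    rw [show 3 / (1 - t) + 3 * -(1 / (1 - t)) = 0 by ring, Real.exp_zero]
  calc Real.exp (3 / (1 - t)) * (∫ θ : UnitAddCircle, Real.exp (4 * (cosC θ - 1) / width t ^ 2)) ^ 3
      ≤ Real.exp (3 / (1 - t)) * (width t * Real.sqrt (Real.pi / 32)) ^ 3 :=
        mul_le_mul_of_nonneg_left hpow (Real.exp_pos _).le
    _ = Real.sqrt (Real.pi / 32) ^ 3 := by
        rw [mul_pow, ← mul_assoc, hr3, one_mul]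

/-- Continuity of `y ↦ ‖w(t,y)‖⁴` on the torus (for integrability). -/
theorem continuous_norm_wC_pow (t : ℝ) : Continuous fun y : T3 => ‖wC t y‖ ^ 4 := by
  refine (continuous_norm.comp ?_).pow 4
  unfold wC profile
  refine (continuous_const.mul (Real.continuous_exp.comp ?_)).smul continuous_const
  refine (continuous_finsetSum _ fun i _ => ?_).div_const _
  exact (continuous_cosC.comp (continuous_apply i)).sub continuous_const

/-- The slice quantity in `ℝ≥0∞`: `∫⁻ ‖w(t,y)‖ₑ⁴ dy ≤ ofReal ((√(π/32))³)` for `t < 1`. -/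
theorem lintegral_wC_le {t : ℝ} (ht : t < 1) :
    ∫⁻ y : T3, ‖wC t y‖ₑ ^ (4 : ℝ) ≤ ENNReal.ofReal (Real.sqrt (Real.pi / 32) ^ 3) := by
  have hint : Integrable (fun y : T3 => ‖wC t y‖ ^ 4) :=
    (continuous_norm_wC_pow t).integrable_of_hasCompactSupport (HasCompactSupport.of_compactSpace _)
  have heq : ∀ y : T3, ‖wC t y‖ₑ ^ (4 : ℝ) = ENNReal.ofReal (‖wC t y‖ ^ 4) := by
    intro y
    rw [← ofReal_norm, ENNReal.ofReal_rpow_of_nonneg (norm_nonneg _) (by norm_num)]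
    congr 1
    exact_mod_cast Real.rpow_natCast ‖wC t y‖ 4
  simp_rw [heq]
  rw [← ofReal_integral_eq_lintegral_ofReal hint (Eventually.of_forall fun y => by positivity)]
  exact ENNReal.ofReal_le_ofReal (integral_norm_wC_pow_four_le ht)

/-- The `L^{8/3}((0,1); L⁴(𝕋³))` quantity of the witness is finite. -/
theorem timeIntegral_wC_lt_top :
    (∫⁻ t in Ioo (0 : ℝ) 1, (∫⁻ y : T3, ‖wC t y‖ₑ ^ (4 : ℝ)) ^ ((2 : ℝ) / 3)) < ⊤ := by
  set K : ℝ≥0∞ := ENNReal.ofReal (Real.sqrt (Real.pi / 32) ^ 3) ^ ((2 : ℝ) / 3) with hK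
  have hKfin : K < ⊤ := ENNReal.rpow_lt_top_of_nonneg (by norm_num) ENNReal.ofReal_ne_top
  have hle : ∫⁻ t in Ioo (0 : ℝ) 1, (∫⁻ y : T3, ‖wC t y‖ₑ ^ (4 : ℝ)) ^ ((2 : ℝ) / 3) ≤
      ∫⁻ _ in Ioo (0 : ℝ) 1, K :=
    setLIntegral_mono measurable_const fun t ht =>
      ENNReal.rpow_le_rpow (lintegral_wC_le ht.2) (by norm_num)
  refine lt_of_le_of_lt hle ?_
  rw [setLIntegral_const, Real.volume_Ioo]
  exact ENNReal.mul_lt_top hKfin (by simp)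

/-! ## The cone bound fails for every admissible `(μ, λ)` -/

/-- `exp(−1/u) < u` for `u > 0`. -/
theorem exp_neg_inv_lt {u : ℝ} (hu : 0 < u) : Real.exp (-(1 / u)) < u := by
  have h1 : 1 / u < Real.exp (1 / u) := lt_of_lt_of_le (by linarith) (Real.add_one_le_exp (1 / u))
  rw [Real.exp_neg]
  have h2 := (inv_lt_inv₀ (Real.exp_pos _) (by positivity : (0 : ℝ) < 1 / u)).2 h1
  simpa using h2

/-- At the cone point `(1 − u, r·e₀)` the witness has size `A(t)·exp((cos 2πr − 1)/r²) ≥ A(t)e^{−2π²}`. -/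
theorem norm_wC_conePoint (t : ℝ) :
    ‖wC t (Torus.proj (EuclideanSpace.single 0 (width t)))‖ =
      amp t * Real.exp ((Real.cos (2 * Real.pi * width t) - 1) / width t ^ 2) := by
  rw [wC_proj, norm_smul, norm_single_zero, abs_one, mul_one]
  have hsum : (∑ i : Fin 3, (Real.cos (2 * Real.pi * (EuclideanSpace.single 0 (width t) : E3) i) - 1)) =
      Real.cos (2 * Real.pi * width t) - 1 := by
    simp [Fin.sum_univ_three]; ring
  rw [hsum, Real.norm_of_nonneg (mul_pos (amp_pos t) (Real.exp_pos _)).le]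

/-- The Gaussian-tip factor is at least `e^{−2π²}`: `(cos 2πr − 1)/r² ≥ −2π²` for `r > 0`. -/
theorem tip_factor_ge {r : ℝ} (hr : 0 < r) :
    Real.exp (-(2 * Real.pi ^ 2)) ≤ Real.exp ((Real.cos (2 * Real.pi * r) - 1) / r ^ 2) := by
  rw [Real.exp_le_exp, le_div_iff₀ (by positivity)]
  have := Real.one_sub_sq_div_two_le_cos (x := 2 * Real.pi * r)
  nlinarith

/-- **Violation**: for every `c` and every `μ < 3/8`, `λ < 3/4` (the signs of `μ, λ` are not needed) there
is a cone point below `(1, 0)` where the weighted size of the witness exceeds `c`. -/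
theorem cone_bound_violated (c μ lam : ℝ) (hμ : μ < 3 / 8) (hl : lam < 3 / 4) :
    ∃ t : ℝ, ∃ x : E3, (t, x) ∈ cone 0 1 0 ∧
      c < ‖wC t (Torus.proj x)‖ * ((1 - t) ^ μ * ‖x - 0‖ ^ lam) := by
  -- constants
  set a : ℝ := 3 / 4 - lam with ha
  have ha0 : 0 < a := by rw [ha]; linarith
  set K₁ : ℝ := Real.exp (-(2 * Real.pi ^ 2)) with hK₁
  have hK₁0 : 0 < K₁ := Real.exp_pos _
  have hc1 : 0 < |c| + 1 := by positivity
  set m : ℝ := min (1 / 2) (K₁ * a / (|c| + 1)) with hm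
  have hm0 : 0 < m := lt_min (by norm_num) (by positivity)
  have hmhalf : m ≤ 1 / 2 := min_le_left _ _
  have hmle : m ≤ K₁ * a / (|c| + 1) := min_le_right _ _
  set u : ℝ := m ^ 2 with hu
  have hu0 : 0 < u := by positivity
  have hu1 : u ≤ 1 := by rw [hu]; nlinarith
  have hult : u < 1 := by rw [hu]; nlinarith
  -- the point
  have hr : 0 < width (1 - u) := width_pos _
  refine ⟨1 - u, EuclideanSpace.single 0 (width (1 - u)), ?_, ?_⟩
  · -- cone membership: `0 < 1 - u < 1` and `‖x‖ = r < u`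
    simp only [cone, mem_setOf_eq, sub_zero, norm_single_zero]
    refine ⟨by linarith, by linarith, ?_⟩
    rw [abs_of_pos hr, width, sub_sub_cancel]
    have := exp_neg_inv_lt hu0
    linarith
  · -- the size
    rw [sub_zero, norm_single_zero, abs_of_pos hr, norm_wC_conePoint, sub_sub_cancel]
    -- `r^λ = exp(−λ/u)` and `A·r^λ = exp(a/u) ≥ a/u`
    have hrl : width (1 - u) ^ lam = Real.exp (-(1 / u) * lam) := by
      rw [width, sub_sub_cancel, Real.exp_mul]
    have hAr : amp (1 - u) * width (1 - u) ^ lam = Real.exp (a / u) := by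
      rw [hrl, amp, sub_sub_cancel, ← Real.exp_add]
      congr 1
      rw [ha]; field_simp; ring
    have hexp_ge : a / u ≤ Real.exp (a / u) := by linarith [Real.add_one_le_exp (a / u)]
    -- `u^μ · (a/u) = a · u^(μ-1) ≥ a · u^(-1/2) = a / m`
    have hupow : u ^ (μ - 1) = u ^ μ / u := Real.rpow_sub_one hu0.ne' μ
    have hmono : u ^ (-(1 / 2 : ℝ)) ≤ u ^ (μ - 1) :=
      Real.rpow_le_rpow_of_exponent_ge hu0 hu1 (by linarith)
    have huhalf : u ^ (-(1 / 2 : ℝ)) = m⁻¹ := by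
      rw [hu, show (m ^ 2 : ℝ) = m ^ (2 : ℝ) by exact_mod_cast (Real.rpow_natCast m 2).symm,
        ← Real.rpow_mul hm0.le, show (2 : ℝ) * -(1 / 2) = -1 by norm_num, Real.rpow_neg_one]
    -- assemble the lower bound `K₁ · a / m`
    have htip := tip_factor_ge hr
    have hmain : K₁ * a / m ≤
        amp (1 - u) * Real.exp ((Real.cos (2 * Real.pi * width (1 - u)) - 1) / width (1 - u) ^ 2) *
          (u ^ μ * width (1 - u) ^ lam) := by
      have hupos : 0 < u ^ μ := Real.rpow_pos_of_pos hu0 μ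
      calc K₁ * a / m = K₁ * (a * u ^ (-(1 / 2 : ℝ))) := by rw [huhalf]; ring
        _ ≤ K₁ * (a * u ^ (μ - 1)) := by gcongr
        _ = K₁ * (u ^ μ * (a / u)) := by rw [hupow]; ring
        _ ≤ Real.exp ((Real.cos (2 * Real.pi * width (1 - u)) - 1) / width (1 - u) ^ 2) *
              (u ^ μ * Real.exp (a / u)) := by gcongr
        _ = amp (1 - u) * Real.exp ((Real.cos (2 * Real.pi * width (1 - u)) - 1) / width (1 - u) ^ 2) *
              (u ^ μ * width (1 - u) ^ lam) := by rw [← hAr]; ring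
    -- and `K₁ · a / m ≥ |c| + 1 > c`
    have hfinal : |c| + 1 ≤ K₁ * a / m := by
      calc |c| + 1 = K₁ * a / (K₁ * a / (|c| + 1)) := by field_simp
        _ ≤ K₁ * a / m := div_le_div_of_nonneg_left (by positivity) hm0 hmle
    linarith [le_abs_self c]

/-- **Refutes `Kampen2015.Step_1Abs` — the rule behind (12)–(13) p. 3 [refuted-substantive at the typed
function grain]**: the field `wC` on `(0,1) × 𝕋³` has a smooth lift and finite `L^{8/3}_tL⁴_x` quantity,
yet violates every cone bound `|w|·(t_s − t)^μ|x − x_s|^λ ≤ c` with `0 ≤ μ < 3/8`, `0 ≤ λ < 3/4` below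
`(t_s, x_s) = (1, 0)`. No cheap repair: the exponents 3/8, 3/4 are exactly the integrability thresholds,
and concentration at a super-polynomial rate `r(t) = e^{−1/(1−t)}` defeats every `λ < 3/4` at once; the
PDE-grain `Step_1` (Leray–Hopf representatives) is a different, un-derived assertion. [cite: Kampen2015CKN,
(5) (8) p. 2, (12)–(13) p. 3] -/
theorem not_Step_1Abs : ¬ Literature.Claims.NS.Kampen2015.Step_1Abs := by
  intro h
  obtain ⟨c, μ, lam, _hμ0, hμ, _hl0, hl, hb⟩ :=
    h 0 1 0 wC one_pos contDiffOn_wC timeIntegral_wC_lt_top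
  obtain ⟨t, x, hcone, hlt⟩ := cone_bound_violated c μ lam hμ hl
  exact absurd (hb t x hcone) (not_le.2 hlt)

end

end Summit.NavierStokesRegularity.NavierStokesRegularity.Theorems.Kampen2015
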